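import Mathlib
import Summits.ValiantsHypothesis.ValiantsHypothesis.Theses.FreeSubtorus
import Summits.ValiantsHypothesis.ValiantsHypothesis.Theorems.FreeSubtorusSubtorusCovering
import Summits.ValiantsHypothesis.ValiantsHypothesis.Cruxes.OrbitDimensionBound.Lines.ConfusionLadder
import Summits.ValiantsHypothesis.ValiantsHypothesis.Theorems.DetqpThesis.Negative.IffPerNotVQP
import Literature.Computability.AlgebraicComplexity.ValiantConjectureEquivProofs
import Literature.Computability.AlgebraicComplexity.StandardFamiliesProofs
import Literature.Computability.AlgebraicComplexity.PBoundedGrowth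
import Literature.Computability.AlgebraicComplexity.DetInVP
import Literature.Computability.AlgebraicComplexity.EquivariantDC
import Literature.Computability.AlgebraicComplexity.LandsbergRessayreNormalForm
import Literature.RingTheory.MvPolynomial.KaltofenNoetherFormsDegreeProofs

/-!
# `DegreeLadder` — forward rung g7 on the crux `FreeSubtorus.OrbitDimensionBound`

FORWARD GENERATOR G1 (next-rung), unit `fwd2-rung-ValiantsHypothesis-01-g7`.

* FLOOR (proved, `Theorems/FreeSubtorusSubtorusCovering.lean`, `subtorusCovering_proof`):
  `SubtorusCovering` — for `n ≥ 3`, every exactly `T_Λ`-equivariant AFFINE (entries of total degree `≤ 1`)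
  determinantal representation `B` of `per_n` of size `m`, `Λ` admissible with `r` generators, has
  `C(n, ⌊n/2⌋) ≤ m · 2^r`.
* THE DIAL `δ` = the total degree allowed in the entries of `B`.  `IsDegEquivariantDetRepr δ Γ f B`:
  entries of total degree `≤ δ`, `det B = f`, every `γ ∈ Γ` lifts to a CONSTANT pair `(g, h) ∈ GL_m × GL_m`
  with `B(γ·x) = g B(x) h⁻¹`.  At `δ = 1` this is `IsEquivariantDetRepr` ON THE NOSE
  (`isDegEquivariantDetRepr_one_iff : … ↔ …` is `Iff.rfl`), so the numeric family below contains the floor as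
  its `δ = 1` member DEFINITIONALLY (`degreeCovering_one_iff`, `Iff.rfl`).
* NUMERIC FAMILY `DegreeCovering δ`: a `T_Λ`-equivariant degree-`δ` representation of `per_n` of size `m`
  (`Λ` admissible, `r` generators) has `C(n, ⌊n/2⌋ + 1 - δ) ≤ m · 2^r` — ONE WINDOW of `δ` consecutive levels
  `[⌊n/2⌋+1-δ, ⌊n/2⌋]` replaces the single middle level of the floor, because a monomial of degree `≤ δ` in an
  entry is an edge of the graded branching program that jumps `≤ δ` levels ("long-edge graded ABP").
  RUNG (numeric): `QuadraticCovering := DegreeCovering 2` (`C(n, ⌊n/2⌋ - 1) ≤ m · 2^r` for quadratic entries).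
* SHADOW (the filed rung declaration, asymptotic, implied by the Statement BY NAME):
  `DegreeShadow δ` — along any sequence of admissible `Λ_n` and `T_{Λ_n}`-equivariant degree-`δ` representations
  `B_n` of `per_n` of size `m_n`, the function `n ↦ (m_n + Σ_{ij} L(B_n[i,j])) · 2^{r_n}` is not p-bounded
  (`L` = the tree's circuit `complexity`; for affine entries `Σ L ≤ m²(2n²+1)` so at `δ = 1` this is the floor's
  shadow `CoveringShadow powLoss` up to a polynomial change of gauge: `degreeShadow_one_iff`).
  `QuadraticShadow := DegreeShadow 2`; `quadraticShadow_of_summit : ValiantsHypothesis → QuadraticShadow` is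
  PROVED here (`aesop` safe rule): a p-bounded such sequence gives `L(per_n) ≤ L(DET_{m_n}) + Σ L(entries)`
  p-bounded (`complexity_aeval_le`, Berkowitz `complexity_detPoly_le`), i.e. `PER` p-computable, i.e.
  `VP_ℂ = VNP_ℂ` (`isPComputable_perPoly_complex_iff`).
* §4 records how the rung relaxes the open crux: `OrbitQuadraticBound` (eventually in `n`, symmetrise INTO a
  quadratic-entry equivariant representation of the same size, same budget `r ≤ ⌊n/2⌋`; implied by the crux),
  `closes_quadratic : OrbitQuadraticBound → QuadraticCovering → VH` (the window one level below the middle costs a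
  factor `n`, absorbed by the exponential-`dc` glue `vh_of_eventual_window_bound`) and `closes_of_orbitDimensionBound`.

Informal source of the dial: Landsberg–Ressayre define `edc` only for affine (degree-1) representations
[cite: LandsbergRessayre2017, Question 2.2, Def. 1.3]; at the other end of the degree axis, Dawar–Wilsenach prove
exponential lower bounds for PERMUTATION-symmetric CIRCUITS (gates of any degree) computing `per_n` and note that their
model is incomparable with `edc` [cite: DawarWilsenach2025, §7.4, Cor. 7.12].  Degree-`δ` determinantal representations
with torus equivariance sit strictly between the two and are not treated in either.  (The g6 seat set the entry-degree
dial aside as "not a consequence of S"; the complexity gauge `m + Σ L(entries)` of `DegreeShadow` is what makes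
`S → shadow` a theorem here, and at `δ = 1` it is the floor's gauge up to a polynomial: `degreeShadow_one_iff`.)
Everything in this file is PROVED (no `sorry`); the numeric rung for `δ ≥ 2` is the content of the registered skeleton
`Lines/quadratic_covering.lean` (three stubs: graded lift, window weights, window count).
-/

open Matrix MvPolynomial Finset
open Literature.Computability.AlgebraicComplexity

-- the mandated summit-side namespace repeats a component by design (single-problem summit)
set_option linter.dupNamespace false

namespace Summit.ValiantsHypothesis.ValiantsHypothesis.Cruxes.OrbitDimensionBound.Degree

noncomputable section

universe u v

/-! ## §1 Degree-`δ` equivariant determinantal representations (the dial) -/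

section General

variable {k : Type u} [CommRing k] {σ : Type v} [Fintype σ] [DecidableEq σ]

/-- **Degree-`δ` `Γ`-equivariant determinantal representation** of `f`: entries of total degree `≤ δ`,
`det A = f`, and every `γ ∈ Γ` lifts to constant `(g, h) ∈ GL_m × GL_m` with `A(γ·x) = g · A(x) · h⁻¹`.
At `δ = 1` this is literally `IsEquivariantDetRepr` (Landsberg–Ressayre 2017, Def. 1.3).
[cite: LandsbergRessayre2017, Def. 1.3] -/
def IsDegEquivariantDetRepr (δ : ℕ) (Γ : Subgroup (GL σ k)) (f : MvPolynomial σ k) {m : ℕ}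
    (A : Matrix (Fin m) (Fin m) (MvPolynomial σ k)) : Prop :=
  ((∀ i j, (A i j).totalDegree ≤ δ) ∧ A.det = f) ∧
    ∀ γ ∈ Γ, ∃ g h : GL (Fin m) k,
      Matrix.linSubstEntries γ A =
        (g : Matrix (Fin m) (Fin m) k).map C * A *
          ((h⁻¹ : GL (Fin m) k) : Matrix (Fin m) (Fin m) k).map C

/-- The dial at `δ = 1` is the tree's notion, definitionally. [cite: LandsbergRessayre2017, Def. 1.3] -/
theorem isDegEquivariantDetRepr_one_iff {Γ : Subgroup (GL σ k)} {f : MvPolynomial σ k} {m : ℕ}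
    {A : Matrix (Fin m) (Fin m) (MvPolynomial σ k)} :
    IsDegEquivariantDetRepr 1 Γ f A ↔ IsEquivariantDetRepr Γ f A := Iff.rfl

/-- The dial is monotone in `δ`. [folklore] -/
theorem IsDegEquivariantDetRepr.mono {δ δ' : ℕ} (hle : δ ≤ δ') {Γ : Subgroup (GL σ k)} {f : MvPolynomial σ k}
    {m : ℕ} {A : Matrix (Fin m) (Fin m) (MvPolynomial σ k)} (h : IsDegEquivariantDetRepr δ Γ f A) :
    IsDegEquivariantDetRepr δ' Γ f A :=
  ⟨⟨fun i j => (h.1.1 i j).trans hle, h.1.2⟩, h.2⟩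

/-- An equivariant affine representation is a degree-`δ` one for every `δ ≥ 1`. [folklore] -/
theorem IsDegEquivariantDetRepr.of_isEquivariantDetRepr {δ : ℕ} (hδ : 1 ≤ δ) {Γ : Subgroup (GL σ k)}
    {f : MvPolynomial σ k} {m : ℕ} {A : Matrix (Fin m) (Fin m) (MvPolynomial σ k)}
    (h : IsEquivariantDetRepr Γ f A) : IsDegEquivariantDetRepr δ Γ f A :=
  (isDegEquivariantDetRepr_one_iff.mpr h).mono hδ

/-- The trivial size bound `deg f ≤ m · δ` (determinant of an `m × m` matrix of degree-`δ` entries). [folklore] -/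
theorem IsDegEquivariantDetRepr.totalDegree_le {δ : ℕ} {Γ : Subgroup (GL σ k)} {f : MvPolynomial σ k} {m : ℕ}
    {A : Matrix (Fin m) (Fin m) (MvPolynomial σ k)} (h : IsDegEquivariantDetRepr δ Γ f A) :
    f.totalDegree ≤ m * δ := by
  rw [← h.1.2]
  simpa [Fintype.card_fin] using
    Literature.RingTheory.MvPolynomial.KaltofenGeneric.totalDegree_det_le_card_mul A h.1.1

end General

/-! ## §2 The numeric family `DegreeCovering δ` over the floor -/

/-- Generators of the subtorus `T_Λ` of the two-sided torus (verbatim from the route file). [cite: LandsbergRessayre2017, §6] -/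
def torusGen (n r : ℕ) (Λ : Fin r → (Fin n ⊕ Fin n) → ℤ) : Set (Matrix.GeneralLinearGroup (Fin n × Fin n) ℂ) :=
  {γ : Matrix.GeneralLinearGroup (Fin n × Fin n) ℂ |
    ∃ d e : Fin n → ℂˣ, (∀ i, (∏ k, (d k) ^ (Λ i (Sum.inl k))) * (∏ l, (e l) ^ (Λ i (Sum.inr l))) = 1) ∧
      (γ : Matrix (Fin n × Fin n) (Fin n × Fin n) ℂ) = Matrix.diagonal (fun p => (d p.1 : ℂ) * (e p.2 : ℂ))}

/-- Admissible lattice data: zero row-sums and zero column-sums (homotheties excluded). [cite: LandsbergRessayre2017, §6] -/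
def Admissible (n r : ℕ) (Λ : Fin r → (Fin n ⊕ Fin n) → ℤ) : Prop :=
  ∀ i, (∑ k, Λ i (Sum.inl k)) = 0 ∧ (∑ l, Λ i (Sum.inr l)) = 0

/-- **`DegreeCovering δ`** (numeric family, graded by the entry degree `δ`): for `n ≥ 3`, a `T_Λ`-equivariant
(exact constant lifts) determinantal representation of `per_n` of size `m` with entries of total degree `≤ δ`,
`Λ` admissible with `r` generators, has `C(n, ⌊n/2⌋ + 1 - δ) ≤ m · 2^r`: the window of `δ` consecutive levels
`[⌊n/2⌋+1-δ, ⌊n/2⌋]` of the Boolean lattice is crossed by every permutation's path in the graded normal form, and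
each weight class inside it has `≤ 2^r` members (Odlyzko).  `δ = 1` is the floor (`degreeCovering_one_iff`).
[cite: LandsbergRessayre2017, Thm. 2.8, §6] [cite: Vonzurgathen1987, Thm. 3.1] -/
def DegreeCovering (δ : ℕ) : Prop :=
  ∀ n : ℕ, 3 ≤ n → ∀ (m r : ℕ) (Λ : Fin r → (Fin n ⊕ Fin n) → ℤ)
    (B : Matrix (Fin m) (Fin m) (MvPolynomial (Fin n × Fin n) ℂ)),
    Admissible n r Λ →
    IsDegEquivariantDetRepr δ (Subgroup.closure (torusGen n r Λ)) (perPoly (Fin n) ℂ) B →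
    Nat.choose n (n / 2 + 1 - δ) ≤ m * 2 ^ r

/-- **The floor is the `δ = 1` member, definitionally.** [cite: LandsbergRessayre2017, Thm. 2.8] -/
theorem degreeCovering_one_iff :
    DegreeCovering 1 ↔ Summit.ValiantsHypothesis.ValiantsHypothesis.Theses.FreeSubtorus.SubtorusCovering :=
  Iff.rfl

/-- Hence `DegreeCovering 1` is a theorem (the floor, `subtorusCovering_proof`). [cite: LandsbergRessayre2017, Thm. 2.8] -/
theorem degreeCovering_one : DegreeCovering 1 :=
  degreeCovering_one_iff.mpr
    Summit.ValiantsHypothesis.ValiantsHypothesis.Theorems.FreeSubtorusSubtorusCovering.subtorusCovering_proof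

/-- There is no degree-`0` (constant) determinantal representation of `per_n`, `n ≥ 1`: `deg per_n = n`. [folklore] -/
theorem not_isDegEquivariantDetRepr_zero {n m : ℕ} (hn : 1 ≤ n) {Γ : Subgroup (GL (Fin n × Fin n) ℂ)}
    {B : Matrix (Fin m) (Fin m) (MvPolynomial (Fin n × Fin n) ℂ)}
    (hB : IsDegEquivariantDetRepr 0 Γ (perPoly (Fin n) ℂ) B) : False := by
  have h1 := hB.totalDegree_le
  have h2 : (perPoly (Fin n) ℂ).totalDegree = n := by
    rw [perPoly_isHomogeneous.totalDegree (perPoly_ne_zero (Fin n) ℂ), Fintype.card_fin]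
  rw [h2, Nat.mul_zero] at h1
  omega

/-- The `δ = 0` member holds vacuously. [folklore] -/
theorem degreeCovering_zero : DegreeCovering 0 := by
  intro n hn m r Λ B _ hB
  exact (not_isDegEquivariantDetRepr_zero (by omega) hB).elim

/-- A representation of `per_n` (`n ≥ 1`) has size `m ≥ 1`. [folklore] -/
theorem one_le_size {δ n m : ℕ} (hn : 1 ≤ n) {Γ : Subgroup (GL (Fin n × Fin n) ℂ)}
    {B : Matrix (Fin m) (Fin m) (MvPolynomial (Fin n × Fin n) ℂ)}
    (hB : IsDegEquivariantDetRepr δ Γ (perPoly (Fin n) ℂ) B) : 1 ≤ m := by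
  rcases Nat.eq_zero_or_pos m with h0 | h0
  · subst h0
    exfalso
    have h3 : B.det = 1 := Matrix.det_isEmpty
    have h4 := congrArg constantCoeff hB.1.2
    rw [h3, constantCoeff_perPoly ℂ hn, map_one] at h4
    exact one_ne_zero h4
  · exact h0

/-- Beyond the middle (`δ > ⌊n/2⌋`) the window statement only records `1 ≤ m · 2^r`. [folklore] -/
theorem degreeCovering_of_lt {δ : ℕ} (n : ℕ) (hn : 3 ≤ n) (hδ : n / 2 < δ) (m r : ℕ)
    (Λ : Fin r → (Fin n ⊕ Fin n) → ℤ) (B : Matrix (Fin m) (Fin m) (MvPolynomial (Fin n × Fin n) ℂ))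
    (hB : IsDegEquivariantDetRepr δ (Subgroup.closure (torusGen n r Λ)) (perPoly (Fin n) ℂ) B) :
    Nat.choose n (n / 2 + 1 - δ) ≤ m * 2 ^ r := by
  have h0 : n / 2 + 1 - δ = 0 := by omega
  rw [h0, Nat.choose_zero_right]
  exact le_trans (one_le_size (by omega) hB) (Nat.le_mul_of_pos_right _ Nat.one_le_two_pow)

/-- **Numeric rung `QuadraticCovering`** = the `δ = 2` member: quadratic entries, window `{⌊n/2⌋-1, ⌊n/2⌋}`,
bound `C(n, ⌊n/2⌋ - 1) ≤ m · 2^r`. [cite: LandsbergRessayre2017, Question 2.2] -/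
def QuadraticCovering : Prop := DegreeCovering 2

/-- Top of the dial: every degree. -/
def AllDegreeCovering : Prop := ∀ δ : ℕ, DegreeCovering δ

theorem quadraticCovering_of_all (h : AllDegreeCovering) : QuadraticCovering := h 2

/-! ### Arithmetic of the window level -/

/-- `C(n, k+1) ≤ n · C(n, k)`. [folklore] -/
theorem choose_succ_le_mul_choose (n k : ℕ) : n.choose (k + 1) ≤ n * n.choose k := by
  have h := Nat.choose_succ_right_eq n k
  rcases Nat.eq_zero_or_pos (n.choose (k + 1)) with h0 | hpos
  · rw [h0]; exact Nat.zero_le _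
  · calc n.choose (k + 1) ≤ n.choose (k + 1) * (k + 1) := Nat.le_mul_of_pos_right _ (Nat.succ_pos k)
      _ = n.choose k * (n - k) := h
      _ ≤ n.choose k * n := Nat.mul_le_mul_left _ (Nat.sub_le n k)
      _ = n * n.choose k := Nat.mul_comm _ _

/-- `C(n, ⌊n/2⌋) ≤ n^j · C(n, ⌊n/2⌋ - j)` for `j ≤ ⌊n/2⌋`. [folklore] -/
theorem choose_middle_le_pow_mul (n : ℕ) : ∀ j : ℕ, j ≤ n / 2 → n.choose (n / 2) ≤ n ^ j * n.choose (n / 2 - j)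
  | 0, _ => by simp
  | j + 1, hj => by
      have ih := choose_middle_le_pow_mul n j (by omega)
      have hk : n / 2 - j = (n / 2 - (j + 1)) + 1 := by omega
      calc n.choose (n / 2) ≤ n ^ j * n.choose (n / 2 - j) := ih
        _ = n ^ j * n.choose ((n / 2 - (j + 1)) + 1) := by rw [hk]
        _ ≤ n ^ j * (n * n.choose (n / 2 - (j + 1))) :=
            Nat.mul_le_mul_left _ (choose_succ_le_mul_choose _ _)
        _ = n ^ (j + 1) * n.choose (n / 2 - (j + 1)) := by rw [pow_succ]; ring

/-- The window level `n ↦ C(n, ⌊n/2⌋ + 1 - δ)` is not p-bounded (`δ ≥ 1` fixed). [folklore] -/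
theorem not_isPBounded_choose_window {δ : ℕ} (hδ : 1 ≤ δ) :
    ¬ IsPBounded (fun n => n.choose (n / 2 + 1 - δ)) := by
  intro hPB
  apply not_isPBounded_choose_middle
  have h1 : IsPBounded (fun n => n ^ (δ - 1) * n.choose (n / 2 + 1 - δ)) :=
    IsPBounded.mul_holds (IsPBounded.pow_holds IsPBounded.id (δ - 1)) hPB
  refine IsPBounded.of_eventually_le (2 * δ) h1 fun n hn => ?_
  have h2 := choose_middle_le_pow_mul n (δ - 1) (by omega)
  have h3 : n / 2 - (δ - 1) = n / 2 + 1 - δ := by omega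
  rw [h3] at h2
  exact h2

/-! ## §3 The asymptotic shadow `DegreeShadow δ` and the on-path lemma `S → shadow` -/

/-- **Asymptotic shadow of `DegreeCovering δ`** (the filed rung declaration at `δ = 2`).  Along ANY sequence of
admissible `Λ_n` and `T_{Λ_n}`-equivariant degree-`δ` determinantal representations `B_n` of `per_n` of sizes `m_n`
(`n ≥ 3`), the function `n ↦ (m_n + Σ_{i,j} L(B_n[i,j])) · 2^{r_n}` is not p-bounded (`L` = circuit complexity of
the entry; for affine entries this term is polynomial in `m_n, n`, see `degreeShadow_one_iff`).
[cite: LandsbergRessayre2017, Question 2.2] [cite: Burgisser2000, Def. 2.1] -/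
def DegreeShadow (δ : ℕ) : Prop :=
  ∀ (m r : ℕ → ℕ) (Λ : (n : ℕ) → Fin (r n) → (Fin n ⊕ Fin n) → ℤ)
    (B : (n : ℕ) → Matrix (Fin (m n)) (Fin (m n)) (MvPolynomial (Fin n × Fin n) ℂ)),
    (∀ n : ℕ, 3 ≤ n → Admissible n (r n) (Λ n) ∧
      IsDegEquivariantDetRepr δ (Subgroup.closure (torusGen n (r n) (Λ n))) (perPoly (Fin n) ℂ) (B n)) →
    ¬ IsPBounded (fun n => (m n + ∑ p : Fin (m n) × Fin (m n), complexity (B n p.1 p.2)) * 2 ^ (r n))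

/-- **RUNG DECLARATION `QuadraticShadow`** := `DegreeShadow 2`. [cite: LandsbergRessayre2017, Question 2.2] -/
def QuadraticShadow : Prop := DegreeShadow 2

/-- The shadow dial is antitone: more entries allowed, fewer sequences excluded. [folklore] -/
theorem DegreeShadow.anti {δ δ' : ℕ} (hle : δ ≤ δ') (h : DegreeShadow δ') : DegreeShadow δ :=
  fun m r Λ B hyp => h m r Λ B fun n hn => ⟨(hyp n hn).1, (hyp n hn).2.mono hle⟩

/-- The `δ = 0` shadow holds vacuously (no constant representation of `per_3`). [folklore] -/
theorem degreeShadow_zero : DegreeShadow 0 := fun _ _ _ _ hyp _ =>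
  not_isDegEquivariantDetRepr_zero (by norm_num) (hyp 3 le_rfl).2

/-- **Numeric rung ⇒ shadow** (`δ ≥ 1`): `C(n, ⌊n/2⌋+1-δ) ≤ m_n 2^{r_n} ≤ (m_n + ΣL) 2^{r_n}` and the window level is
not p-bounded. [folklore] -/
theorem degreeShadow_of_degreeCovering {δ : ℕ} (hδ : 1 ≤ δ) (h : DegreeCovering δ) : DegreeShadow δ := by
  intro m r Λ B hyp hPB
  refine not_isPBounded_choose_window hδ (IsPBounded.of_eventually_le 3 hPB fun n hn => ?_)
  calc n.choose (n / 2 + 1 - δ) ≤ m n * 2 ^ (r n) := h n hn (m n) (r n) (Λ n) (B n) (hyp n hn).1 (hyp n hn).2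
    _ ≤ (m n + ∑ p : Fin (m n) × Fin (m n), complexity (B n p.1 p.2)) * 2 ^ (r n) :=
        Nat.mul_le_mul_right _ (Nat.le_add_right _ _)

/-- All degrees: rung ⇒ shadow. [folklore] -/
theorem degreeShadow_of_degreeCovering' {δ : ℕ} (h : DegreeCovering δ) : DegreeShadow δ := by
  rcases Nat.eq_zero_or_pos δ with h0 | hpos
  · subst h0; exact degreeShadow_zero
  · exact degreeShadow_of_degreeCovering hpos h

/-- The floor's shadow in this gauge, unconditionally (from the proved floor). [cite: LandsbergRessayre2017, Thm. 2.8] -/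
theorem degreeShadow_one : DegreeShadow 1 := degreeShadow_of_degreeCovering le_rfl degreeCovering_one

/-- `L(det B) ≤ L(DET_m) + Σ L(B[i,j])` (substitution into a circuit for `DET_m`). [cite: Burgisser2000, Rem. 2.7] -/
theorem complexity_det_le {σ : Type v} [Fintype σ] {m : ℕ} (B : Matrix (Fin m) (Fin m) (MvPolynomial σ ℂ)) :
    complexity B.det ≤ complexity (detPoly (Fin m) ℂ) + ∑ p : Fin m × Fin m, complexity (B p.1 p.2) := by
  have hf : B.det = aeval (fun p : Fin m × Fin m => B p.1 p.2) (detPoly (Fin m) ℂ) := by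
    rw [detPoly, AlgHom.map_det, Matrix.mvPolynomialX_mapMatrix_aeval]
  rw [hf]
  exact complexity_aeval_le _ _

/-- **ON-PATH LEMMA `S → DegreeShadow δ`** (every `δ`): a p-bounded sequence gives p-bounded circuits for `(per_n)`
(`L(per_n) ≤ 8(m_n+1)^7 + Σ L(entries)`), i.e. `PER` is p-computable, i.e. `VP_ℂ = VNP_ℂ`
(`isPComputable_perPoly_complex_iff`). [cite: Burgisser2000, Rem. 2.11, Thm. 2.10] -/
@[aesop safe apply]
theorem degreeShadow_of_summit (δ : ℕ) (hS : _root_.ValiantsHypothesis) : DegreeShadow δ := by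
  intro m r Λ B hyp hPB
  set t : ℕ → ℕ := fun n => (m n + ∑ p : Fin (m n) × Fin (m n), complexity (B n p.1 p.2)) * 2 ^ (r n)
    with ht_def
  have hm : ∀ n, m n ≤ t n := fun n =>
    le_trans (Nat.le_add_right _ _) (Nat.le_mul_of_pos_right _ Nat.one_le_two_pow)
  have hsum : ∀ n, ∑ p : Fin (m n) × Fin (m n), complexity (B n p.1 p.2) ≤ t n := fun n =>
    le_trans (Nat.le_add_left _ _) (Nat.le_mul_of_pos_right _ Nat.one_le_two_pow)
  let F : ℕ → ℕ := fun n => 8 * (t n + 1) ^ 7 + t n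
  have hF : IsPBounded F := by
    have ht : IsPBounded t := hPB
    have h1 : IsPBounded fun n => t n + 1 := IsPBounded.add_holds ht (IsPBounded.const 1)
    have h2 : IsPBounded fun n => (t n + 1) ^ 7 := IsPBounded.pow_holds h1 7
    have h3 : IsPBounded fun n => 8 * (t n + 1) ^ 7 := IsPBounded.mul_holds (IsPBounded.const 8) h2
    exact IsPBounded.add_holds h3 ht
  have hL : IsPComputable (fun n => perPoly (Fin n) ℂ) := by
    refine IsPBounded.of_eventually_le 3 hF fun n hn => ?_
    have hdet : (B n).det = perPoly (Fin n) ℂ := (hyp n hn).2.1.2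
    show complexity (perPoly (Fin n) ℂ) ≤ F n
    rw [← hdet]
    refine (complexity_det_le (B n)).trans ?_
    have h8 := complexity_detPoly_le ℂ (m n)
    show complexity (detPoly (Fin (m n)) ℂ) + ∑ p : Fin (m n) × Fin (m n), complexity (B n p.1 p.2) ≤
      8 * (t n + 1) ^ 7 + t n
    have hmn := hm n
    have hsumn := hsum n
    gcongr
    calc complexity (detPoly (Fin (m n)) ℂ) ≤ 8 * (m n + 1) ^ 7 := h8
      _ ≤ 8 * (t n + 1) ^ 7 := by gcongr
  have hEq : VP ℂ = VNP ℂ := isPComputable_perPoly_complex_iff.1 hL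
  exact hS hEq

/-- **`S → QuadraticShadow`** (the rung's on-path lemma, by name; `aesop` safe rule for the tribunal kernel).
[cite: Burgisser2000, Rem. 2.11] -/
@[aesop safe apply]
theorem quadraticShadow_of_summit (hS : _root_.ValiantsHypothesis) : QuadraticShadow :=
  degreeShadow_of_summit 2 hS

/-- For affine entries the complexity term is polynomial: `Σ_{p} L(B p) ≤ m² (2n² + 1)`. [folklore] -/
theorem sum_complexity_le_of_affine {n m : ℕ} {B : Matrix (Fin m) (Fin m) (MvPolynomial (Fin n × Fin n) ℂ)}
    (haff : ∀ i j, (B i j).totalDegree ≤ 1) :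
    ∑ p : Fin m × Fin m, complexity (B p.1 p.2) ≤ m ^ 2 * (2 * (n * n) + 1) := by
  calc ∑ p : Fin m × Fin m, complexity (B p.1 p.2) ≤ ∑ _p : Fin m × Fin m, (2 * (n * n) + 1) :=
        Finset.sum_le_sum fun p _ => by
          simpa [Fintype.card_fin] using
            Summit.ValiantsHypothesis.Theorems.DetqpThesis.Negative.complexity_le_of_totalDegree_le_one
              (haff p.1 p.2)
    _ = m ^ 2 * (2 * (n * n) + 1) := by simp [sq]

/-- **Change of gauge at `δ = 1`**: the degree-1 shadow is the floor's shadow `CoveringShadow powLoss` of the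
ladder `ConfusionLadder` (the extra complexity term is polynomial in `m_n, n` for affine entries). [folklore] -/
theorem degreeShadow_one_iff : DegreeShadow 1 ↔ Confusion.CoveringShadow Confusion.powLoss := by
  constructor
  · intro h m r Λ B hyp hPB
    refine h m r Λ B (fun n hn => ⟨(hyp n hn).1, isDegEquivariantDetRepr_one_iff.mpr (hyp n hn).2⟩) ?_
    -- `(m + ΣL) 2^r ≤ (m + m²(2n²+1)) 2^r`, p-bounded since `m 2^r` is
    have hPB' : IsPBounded (fun n => m n * 2 ^ (r n)) := hPB
    have hmPB : IsPBounded m := IsPBounded.of_eventually_le 0 hPB' fun n _ =>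
      Nat.le_mul_of_pos_right _ Nat.one_le_two_pow
    have hpoly : IsPBounded (fun n => m n ^ 2 * (2 * (n * n) + 1)) :=
      IsPBounded.mul_holds (IsPBounded.pow_holds hmPB 2)
        (IsPBounded.add_holds (IsPBounded.mul_holds (IsPBounded.const 2)
          (IsPBounded.mul_holds IsPBounded.id IsPBounded.id)) (IsPBounded.const 1))
    have hbig : IsPBounded (fun n => m n * 2 ^ (r n) + m n ^ 2 * (2 * (n * n) + 1) * (m n * 2 ^ (r n))) :=
      IsPBounded.add_holds hPB' (IsPBounded.mul_holds hpoly hPB')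
    refine IsPBounded.of_eventually_le 3 hbig fun n hn => ?_
    have hsum := sum_complexity_le_of_affine (hyp n hn).2.1.1
    have h1 : 1 ≤ m n := one_le_size (δ := 1) (by omega) (isDegEquivariantDetRepr_one_iff.mpr (hyp n hn).2)
    calc (m n + ∑ p : Fin (m n) × Fin (m n), complexity (B n p.1 p.2)) * 2 ^ (r n)
        ≤ (m n + m n ^ 2 * (2 * (n * n) + 1)) * 2 ^ (r n) := by gcongr
      _ = m n * 2 ^ (r n) + m n ^ 2 * (2 * (n * n) + 1) * (1 * 2 ^ (r n)) := by ring
      _ ≤ m n * 2 ^ (r n) + m n ^ 2 * (2 * (n * n) + 1) * (m n * 2 ^ (r n)) := by gcongr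
  · intro h m r Λ B hyp hPB
    refine h m r Λ B (fun n hn => ⟨(hyp n hn).1, isDegEquivariantDetRepr_one_iff.mp (hyp n hn).2⟩) ?_
    exact IsPBounded.of_eventually_le 0 hPB fun n _ =>
      Nat.mul_le_mul_right _ (Nat.le_add_right _ _)

/-- Hence the quadratic shadow implies the floor's shadow. [folklore] -/
theorem powShadow_of_quadraticShadow (h : QuadraticShadow) : Confusion.CoveringShadow Confusion.powLoss :=
  degreeShadow_one_iff.mp (h.anti one_le_two)

/-! ## §4 How the rung relaxes the open crux `OrbitDimensionBound` -/

/-- **`OrbitQuadraticBound`** — the symmetrisation target RELAXED by the rung: eventually in `n`, every affine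
determinantal representation `A` of `per_n` of size `m` can be replaced by a representation `B` OF THE SAME SIZE with
entries of total degree `≤ 2` that is `T_Λ`-equivariant (exact constant lifts) for some admissible `Λ` of rank
`r ≤ ⌊n/2⌋` (the host crux's own budget).  Implied by `OrbitDimensionBound` (`orbitQuadraticBound_of_orbitDimensionBound`:
an affine `B` is quadratic), not conversely: the quadratic freedom in `B` is exactly what the rung pays for (its window
sits one level lower, a factor `n` that the exponential-`dc` glue absorbs).  Like the host crux it is an `∃ B`-statement,
so the in-place refutations of `Cruxes/OrbitDimensionBound/Disproof.lean` §4 do not touch it.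
[cite: LandsbergRessayre2017, Question 2.2, §6] -/
def OrbitQuadraticBound : Prop :=
  ∃ n₀ : ℕ, ∀ n : ℕ, n₀ ≤ n → ∀ (m : ℕ) (A : Matrix (Fin m) (Fin m) (MvPolynomial (Fin n × Fin n) ℂ)),
    IsAffineDetRepr (perPoly (Fin n) ℂ) A →
    ∃ (B : Matrix (Fin m) (Fin m) (MvPolynomial (Fin n × Fin n) ℂ)) (r : ℕ)
      (Λ : Fin r → (Fin n ⊕ Fin n) → ℤ),
      r ≤ n / 2 ∧ Admissible n r Λ ∧
      IsDegEquivariantDetRepr 2 (Subgroup.closure (torusGen n r Λ)) (perPoly (Fin n) ℂ) B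

/-- The host crux implies the relaxed one (an affine equivariant `B` is a quadratic equivariant `B`).
[cite: LandsbergRessayre2017, Question 2.2] -/
theorem orbitQuadraticBound_of_orbitDimensionBound
    (h : Summit.ValiantsHypothesis.ValiantsHypothesis.Theses.FreeSubtorus.OrbitDimensionBound) :
    OrbitQuadraticBound := by
  refine ⟨3, fun n hn m A hA => ?_⟩
  obtain ⟨B, r, Λ, hr, hΛ, hB⟩ := h n hn m A hA
  exact ⟨B, r, Λ, hr, hΛ, IsDegEquivariantDetRepr.of_isEquivariantDetRepr one_le_two hB⟩

/-- Arithmetic: `2^n ≤ (n+1) · C(n, ⌊n/2⌋)`. [folklore] -/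
theorem two_pow_le_succ_mul_choose_middle (n : ℕ) : 2 ^ n ≤ (n + 1) * Nat.choose n (n / 2) := by
  rw [← Nat.sum_range_choose n]
  calc ∑ k ∈ Finset.range (n + 1), Nat.choose n k ≤ ∑ _k ∈ Finset.range (n + 1), Nat.choose n (n / 2) :=
        Finset.sum_le_sum fun k _ => Nat.choose_le_middle k n
    _ = (n + 1) * Nat.choose n (n / 2) := by simp

/-- Arithmetic: `162^j · (2j+2)(2j+1) ≤ 256^j` for `j ≥ 20`. [folklore] -/
theorem aux_pow_bound : ∀ j : ℕ, 20 ≤ j → 162 ^ j * ((2 * j + 2) * (2 * j + 1)) ≤ 256 ^ j := by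
  intro j hj
  induction j, hj using Nat.le_induction with
  | base => norm_num
  | succ j hj ih =>
    have h1 : 162 * ((2 * (j + 1) + 2) * (2 * (j + 1) + 1)) ≤ 256 * ((2 * j + 2) * (2 * j + 1)) := by nlinarith
    calc 162 ^ (j + 1) * ((2 * (j + 1) + 2) * (2 * (j + 1) + 1))
        = 162 ^ j * (162 * ((2 * (j + 1) + 2) * (2 * (j + 1) + 1))) := by ring
      _ ≤ 162 ^ j * (256 * ((2 * j + 2) * (2 * j + 1))) := Nat.mul_le_mul_left _ h1
      _ = 256 * (162 ^ j * ((2 * j + 2) * (2 * j + 1))) := by ring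
      _ ≤ 256 * 256 ^ j := Nat.mul_le_mul_left _ ih
      _ = 256 ^ (j + 1) := by ring

/-- Arithmetic: `9^n · 2^{⌊n/2⌋} · (n+1) · n ≤ 16^n` for `n ≥ 40`. [folklore] -/
theorem nine_pow_bound' (n : ℕ) (hn : 40 ≤ n) : 9 ^ n * 2 ^ (n / 2) * ((n + 1) * n) ≤ 16 ^ n := by
  obtain ⟨j, rfl | rfl⟩ := Nat.even_or_odd' n
  · have hj : 20 ≤ j := by omega
    have h := aux_pow_bound j hj
    have e1 : (2 * j) / 2 = j := by omega
    rw [e1]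
    calc 9 ^ (2 * j) * 2 ^ j * ((2 * j + 1) * (2 * j))
        = 162 ^ j * ((2 * j + 1) * (2 * j)) := by rw [pow_mul, ← mul_pow]; norm_num
      _ ≤ 162 ^ j * ((2 * j + 2) * (2 * j + 1)) := Nat.mul_le_mul_left _ (by nlinarith)
      _ ≤ 256 ^ j := h
      _ = 16 ^ (2 * j) := by rw [pow_mul]; norm_num
  · have hj : 20 ≤ j := by omega
    have h := aux_pow_bound j hj
    have e1 : (2 * j + 1) / 2 = j := by omega
    rw [e1]
    calc 9 ^ (2 * j + 1) * 2 ^ j * ((2 * j + 1 + 1) * (2 * j + 1))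
        = 9 * (162 ^ j * ((2 * j + 2) * (2 * j + 1))) := by
          rw [pow_succ, pow_mul, show (9:ℕ) ^ 2 = 81 by norm_num,
            show (81:ℕ) ^ j * 9 * 2 ^ j = 9 * (81 ^ j * 2 ^ j) by ring, ← mul_pow]
          norm_num; ring
      _ ≤ 9 * 256 ^ j := Nat.mul_le_mul_left _ h
      _ ≤ 16 * 256 ^ j := Nat.mul_le_mul_right _ (by norm_num)
      _ = 16 ^ (2 * j + 1) := by rw [pow_succ, pow_mul]; norm_num; ring

/-- **Eventual next-to-middle bound ⇒ VH**: if `C(n, ⌊n/2⌋-1) ≤ dc(per_n) · 2^{⌊n/2⌋}` for all large `n` then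
`VP_ℂ ≠ VNP_ℂ`.  Arithmetic `(9/8)^n ≤ dc(per_n)` for `n ≥ 40` (`2^n ≤ (n+1)·n·C(n,⌊n/2⌋-1)`), then the tree's
`expDcGlue_proof` (exponential `dc` ⇒ VH). [cite: Burgisser2000, Thm. 2.10] [cite: BurgisserClausenShokrollahi1997, Cor. (21.40)] -/
theorem vh_of_eventual_window_bound (n₀ : ℕ)
    (hstep : ∀ n : ℕ, n₀ ≤ n →
      Nat.choose n (n / 2 - 1) ≤ determinantalComplexity (perPoly (Fin n) ℂ) * 2 ^ (n / 2)) :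
    _root_.ValiantsHypothesis := by
  apply Summit.ValiantsHypothesis.Theorems.expDcGlue_proof
  refine ⟨9 / 8, by norm_num, max n₀ 40, fun n hn => ?_⟩
  have hn₀ : n₀ ≤ n := le_trans (le_max_left _ _) hn
  have h40 : 40 ≤ n := le_trans (le_max_right _ _) hn
  have hs := hstep n hn₀
  have hA := nine_pow_bound' n h40
  have hB : 2 ^ n ≤ (n + 1) * n * Nat.choose n (n / 2 - 1) := by
    have h2 : n.choose (n / 2) ≤ n * n.choose (n / 2 - 1) := by
      simpa using choose_middle_le_pow_mul n 1 (by omega)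
    calc 2 ^ n ≤ (n + 1) * Nat.choose n (n / 2) := two_pow_le_succ_mul_choose_middle n
      _ ≤ (n + 1) * (n * n.choose (n / 2 - 1)) := Nat.mul_le_mul_left _ h2
      _ = (n + 1) * n * Nat.choose n (n / 2 - 1) := by ring
  set D : ℕ := determinantalComplexity (perPoly (Fin n) ℂ) with hD
  have hsR : (Nat.choose n (n / 2 - 1) : ℝ) ≤ (D : ℝ) * (2 : ℝ) ^ (n / 2) := by exact_mod_cast hs
  have hAR : (9 : ℝ) ^ n * (2 : ℝ) ^ (n / 2) * (((n : ℝ) + 1) * (n : ℝ)) ≤ (16 : ℝ) ^ n := by exact_mod_cast hA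
  have hBR : (2 : ℝ) ^ n ≤ ((n : ℝ) + 1) * (n : ℝ) * (Nat.choose n (n / 2 - 1) : ℝ) := by exact_mod_cast hB
  have hnpos : (0 : ℝ) < (n : ℝ) := by exact_mod_cast (show 0 < n by omega)
  have hposP : (0 : ℝ) < (8 : ℝ) ^ n * (2 : ℝ) ^ (n / 2) * (((n : ℝ) + 1) * (n : ℝ)) := by positivity
  have h8 : (0 : ℝ) ≤ (8 : ℝ) ^ n := by positivity
  have hnn : (0 : ℝ) ≤ ((n : ℝ) + 1) * (n : ℝ) := by positivity
  have key : (9 / 8 : ℝ) ^ n * ((8 : ℝ) ^ n * (2 : ℝ) ^ (n / 2) * (((n : ℝ) + 1) * (n : ℝ))) ≤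
      (D : ℝ) * ((8 : ℝ) ^ n * (2 : ℝ) ^ (n / 2) * (((n : ℝ) + 1) * (n : ℝ))) := by
    have e1 : (9 / 8 : ℝ) ^ n * ((8 : ℝ) ^ n * (2 : ℝ) ^ (n / 2) * (((n : ℝ) + 1) * (n : ℝ))) =
        (9 : ℝ) ^ n * (2 : ℝ) ^ (n / 2) * (((n : ℝ) + 1) * (n : ℝ)) := by
      rw [div_pow]; field_simp
    have e2 : (16 : ℝ) ^ n = (8 : ℝ) ^ n * (2 : ℝ) ^ n := by rw [← mul_pow]; norm_num
    rw [e1]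
    calc (9 : ℝ) ^ n * (2 : ℝ) ^ (n / 2) * (((n : ℝ) + 1) * (n : ℝ)) ≤ (16 : ℝ) ^ n := hAR
      _ = (8 : ℝ) ^ n * (2 : ℝ) ^ n := e2
      _ ≤ (8 : ℝ) ^ n * (((n : ℝ) + 1) * (n : ℝ) * (Nat.choose n (n / 2 - 1) : ℝ)) :=
          mul_le_mul_of_nonneg_left hBR h8
      _ ≤ (8 : ℝ) ^ n * (((n : ℝ) + 1) * (n : ℝ) * ((D : ℝ) * (2 : ℝ) ^ (n / 2))) := by
          apply mul_le_mul_of_nonneg_left _ h8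
          exact mul_le_mul_of_nonneg_left hsR hnn
      _ = (D : ℝ) * ((8 : ℝ) ^ n * (2 : ℝ) ^ (n / 2) * (((n : ℝ) + 1) * (n : ℝ))) := by ring
  exact le_of_mul_le_mul_right key hposP

/-- **Relaxed target + numeric rung ⇒ VH**: for large `n`, an optimal expression `A` of `per_n`
(`hasDetRepr_determinantalComplexity_holds`) is re-realised quadratically and equivariantly at the same size `dc(per_n)`
with `r ≤ ⌊n/2⌋`; the rung gives `C(n,⌊n/2⌋-1) ≤ dc(per_n) · 2^r ≤ dc(per_n) · 2^{⌊n/2⌋}`; `vh_of_eventual_window_bound`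
concludes. [cite: LandsbergRessayre2017, Question 2.2] [cite: Burgisser2000, Thm. 2.10] -/
theorem closes_quadratic (h₁ : OrbitQuadraticBound) (h₂ : QuadraticCovering) : _root_.ValiantsHypothesis := by
  obtain ⟨n₀, h₁⟩ := h₁
  refine vh_of_eventual_window_bound (max n₀ 3) fun n hn => ?_
  have hn₀ : n₀ ≤ n := le_trans (le_max_left _ _) hn
  have hn3 : 3 ≤ n := le_trans (le_max_right _ _) hn
  obtain ⟨A, hA⟩ := hasDetRepr_determinantalComplexity_holds (perPoly (Fin n) ℂ)
  obtain ⟨B, r, Λ, hr, hΛ, hB⟩ := h₁ n hn₀ _ A hA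
  have hcov := h₂ n hn3 _ r Λ B hΛ hB
  have hwin : n / 2 + 1 - 2 = n / 2 - 1 := by omega
  rw [hwin] at hcov
  calc n.choose (n / 2 - 1) ≤ determinantalComplexity (perPoly (Fin n) ℂ) * 2 ^ r := hcov
    _ ≤ determinantalComplexity (perPoly (Fin n) ℂ) * 2 ^ (n / 2) :=
        Nat.mul_le_mul_left _ (Nat.pow_le_pow_right (by norm_num) hr)

/-- The rung also closes the host route with its ORIGINAL crux (`OrbitDimensionBound → QuadraticCovering → VH`).
[cite: LandsbergRessayre2017, Question 2.2] -/
theorem closes_of_orbitDimensionBound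
    (h₁ : Summit.ValiantsHypothesis.ValiantsHypothesis.Theses.FreeSubtorus.OrbitDimensionBound)
    (h₂ : QuadraticCovering) : _root_.ValiantsHypothesis :=
  closes_quadratic (orbitQuadraticBound_of_orbitDimensionBound h₁) h₂

end

end Summit.ValiantsHypothesis.ValiantsHypothesis.Cruxes.OrbitDimensionBound.Degree
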